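import Mathlib
import Summits.ValiantsHypothesis.ValiantsHypothesis.Theses.BarrierLever
import Summits.ValiantsHypothesis.ValiantsHypothesis.Theorems.BarrierLeverPartitionMinorsHitByVPHiddenStatesFit
import Summits.ValiantsHypothesis.ValiantsHypothesis.Theorems.BarrierLeverPartitionMinorsHitByVPHiddenStatesFullJoin
import Summits.ValiantsHypothesis.ValiantsHypothesis.Theorems.BarrierLeverPartitionMinorsHitByVPHiddenStatesFullJoinUniversal

/-!
# Route BarrierLever — item `PartitionMinorsHitByVP` (stmt-ValiantsHypothesis-19717), line `hidden_states`:
# THE R26 ARROWS — the one-sided node UTD and the wide one-cube node FJ-wide imply REGISTERED stubs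

Helper file (`--supports stmt-ValiantsHypothesis-19717`; cell valiant-natproofs, rung V4, 𝒟-side door (c), line
`Cruxes/PartitionMinorsHitByVP/Lines/hidden_states.lean` v9; prover seat val-np-p3 gen 17). Three short kernel arrows asked for by
planner ruling R26 (HOME/STATUS.md l.1573; card `Lines/hidden-states.md` UPDATE v9f (1)). No new definition; closes NO item.

* `universalJoinWide_of_universalThresholdDesign` : `FullJoin.Stmt.universalThresholdDesign → SymbJoin.Stmt.universalJoinWide` — a
  universal ONE-CUBE threshold design (typed node UTD, p679900) is the `m = 1`, `W = 0`, `e k = (0, J k)` case of the line's node #1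
  (`SymbJoin.Stmt.universalJoinWide` = the verbatim body of the registered `Stmt.stub_universalJoinWide`, composition of record). So a
  proof of UTD closes the registered conjecture node by this arrow.
* `fullJoinCubeWide_of_universalThresholdDesign` : `FullJoin.Stmt.universalThresholdDesign → FullJoin.Stmt.fullJoinCubeWide` — rows and
  columns use the SAME universal design with their own tables; the design's extremal weight monomial isolates `det A · det B ≠ 0`
  (`fullJoin_det_ne_zero_of_threshold` with one piece), so the one-cube full hidden sum with `K ≤ h³` states is nonsingular for EVERY pair.
* `fullJoinPairLower_of_fullJoinCubeWide` : `FullJoin.Stmt.fullJoinCubeWide → FullJoin.Stmt.fullJoinPairLower` — one cube is a wide full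
  join with `m = 1`, `κ = 1` (the lower hypotheses are simply dropped); `Stmt.fullJoinPairLower` is the verbatim text of the registered
  weakest node `stub_fullJoinPairLower` (registry v9).

Chain of record after this file (all kernel): UTD ⇒ FJ-wide ⇒ `stub_fullJoinPairLower` ⇒ item (`b = 12`), and UTD ⇒ `stub_universalJoinWide`
⇒ item (`b = 8`, `partitionMinorsHitByVP_of_universalThresholdDesign`).
-/

set_option linter.dupNamespace false

namespace Summit.ValiantsHypothesis.ValiantsHypothesis.Theorems.BarrierLever.HiddenStates

open Finset Matrix

noncomputable section

namespace FullJoin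

/-- **R26 arrow 1: UTD ⇒ the registered conjecture node.** A universal one-cube threshold design is a legal wide join threshold design
with ONE piece (`m = 1 ≤ 2h` for `h ≥ 1`), offset `W = 0` and the same state weights; its goodness for every injective row family is
literally the node's conclusion. -/
theorem universalJoinWide_of_universalThresholdDesign (H : Stmt.universalThresholdDesign) : SymbJoin.Stmt.universalJoinWide := by
  classical
  obtain ⟨h₁, H⟩ := H
  refine ⟨max h₁ 1, fun h hh r hr => ?_⟩
  have hh₁ : h₁ ≤ h := le_trans (le_max_left _ _) hh
  have h1 : 1 ≤ h := le_trans (le_max_right _ _) hh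
  obtain ⟨K, J, wt, hK, hJ, hthr, hgood⟩ := H h hh₁ r hr
  refine ⟨1, K, fun _ => 0, fun _ q => wt q, fun k => ((0 : Fin 1), J k), by omega, hK, ?_, ?_, ?_⟩
  · intro k k' hkk'
    exact hJ (by simpa using hkk')
  · intro x hx i
    have hx2 : x.2 ∉ Set.range J := by
      rintro ⟨k, hk⟩
      apply hx
      refine ⟨k, ?_⟩
      ext
      · simp [Subsingleton.elim x.1 0]
      · simp [hk]
    simpa using hthr x.2 hx2 i
  · intro u hu
    obtain ⟨tx, hx⟩ := hgood u hu
    exact ⟨fun _ => tx, by simpa using hx⟩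

/-- **R26 arrow 2: UTD ⇒ the wide one-cube full-join node (every pair, `K ≤ h³`).** Rows and columns use the same universal design
with their own tables; `fullJoin_det_ne_zero_of_threshold` (one piece, `κ = t₀^0`, `λ_q = t₀^{wt q}`) makes the design product
`det A[·,J] · det B[·,J]` the leading `t₀`-coefficient of the one-cube full hidden sum. -/
theorem fullJoinCubeWide_of_universalThresholdDesign (H : Stmt.universalThresholdDesign) : Stmt.fullJoinCubeWide := by
  classical
  obtain ⟨h₁, H⟩ := H
  refine ⟨h₁, fun h hh r u w hu hw => ?_⟩
  obtain ⟨K, J, wt, hK, hJ, hthr, hgood⟩ := H h hh r (le_two_pow_of_injective u hu)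
  obtain ⟨tx, hx⟩ := hgood u hu
  obtain ⟨ty, hy⟩ := hgood w hw
  have hthr' : ∀ x : Fin 1 × Finset (Fin K), x ∉ Set.range (fun k : Fin r => ((0 : Fin 1), J k)) →
      ∀ i : Fin r, (fun _ : Fin 1 => (0 : ℕ)) ((fun k : Fin r => ((0 : Fin 1), J k)) i).1 +
          ∑ q ∈ ((fun k : Fin r => ((0 : Fin 1), J k)) i).2,
            (fun (_ : Fin 1) (q : Fin K) => wt q) ((fun k : Fin r => ((0 : Fin 1), J k)) i).1 q <
        (fun _ : Fin 1 => (0 : ℕ)) x.1 + ∑ q ∈ x.2, (fun (_ : Fin 1) (q : Fin K) => wt q) x.1 q := by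
    intro x hx' i
    have hx2 : x.2 ∉ Set.range J := by
      rintro ⟨k, hk⟩
      apply hx'
      refine ⟨k, ?_⟩
      ext
      · simp [Subsingleton.elim x.1 0]
      · simp [hk]
    simpa using hthr x.2 hx2 i
  have he : Function.Injective (fun k : Fin r => ((0 : Fin 1), J k)) := fun k k' hkk' => hJ (by simpa using hkk')
  obtain ⟨t₀, hdet⟩ := fullJoin_det_ne_zero_of_threshold h 1 K r u w (fun k => ((0 : Fin 1), J k)) he (fun _ => 0)
    (fun _ q => wt q) hthr' (fun _ => tx) (fun _ => ty) (by simpa using hx) (by simpa using hy)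
  refine ⟨K, tx, ty, fun q => t₀ ^ wt q, hK, ?_⟩
  have hmat : (Matrix.of fun i j : Fin r => ∑ p : Fin 1, ∑ J' : Finset (Fin K),
      t₀ ^ (fun _ : Fin 1 => (0 : ℕ)) p * (∏ k ∈ J', t₀ ^ (fun (_ : Fin 1) (q : Fin K) => wt q) p k) *
      ((∏ a ∈ u i, ((fun _ : Fin 1 => tx) p none a + ∑ q ∈ J', (fun _ : Fin 1 => tx) p (some q) a)) *
        ∏ c ∈ w j, ((fun _ : Fin 1 => ty) p none c + ∑ q ∈ J', (fun _ : Fin 1 => ty) p (some q) c))) =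
      Matrix.of fun i j : Fin r => ∑ J' : Finset (Fin K), (∏ k ∈ J', t₀ ^ wt k) *
        ((∏ a ∈ u i, (tx none a + ∑ q ∈ J', tx (some q) a)) *
          ∏ c ∈ w j, (ty none c + ∑ q ∈ J', ty (some q) c)) := by
    refine Matrix.ext fun i j => ?_
    simp only [Matrix.of_apply, Fin.sum_univ_one, pow_zero, one_mul]
  rw [← hmat]
  exact hdet

/-- **R26 arrow 3: FJ-wide ⇒ the registered weakest node `stub_fullJoinPairLower`.** One cube with `K ≤ h³` states is a wide full
join with `m = 1` piece and piece weight `κ = 1`; the lower-set hypotheses of the pair node are not needed. -/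
theorem fullJoinPairLower_of_fullJoinCubeWide (H : Stmt.fullJoinCubeWide) : Stmt.fullJoinPairLower := by
  obtain ⟨h₁, H⟩ := H
  refine ⟨max h₁ 1, fun h hh r u w hu hw _ _ => ?_⟩
  have hh₁ : h₁ ≤ h := le_trans (le_max_left _ _) hh
  have h1 : 1 ≤ h := le_trans (le_max_right _ _) hh
  obtain ⟨K, tx, ty, lam, hK, hdet⟩ := H h hh₁ r u w hu hw
  refine ⟨1, K, fun _ => tx, fun _ => ty, fun _ => 1, fun _ => lam, by omega, hK, ?_⟩
  have hmat : (Matrix.of fun i j : Fin r => ∑ p : Fin 1, ∑ J : Finset (Fin K),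
      (fun _ : Fin 1 => (1 : ℂ)) p * (∏ k ∈ J, (fun _ : Fin 1 => lam) p k) *
      ((∏ a ∈ u i, ((fun _ : Fin 1 => tx) p none a + ∑ q ∈ J, (fun _ : Fin 1 => tx) p (some q) a)) *
        ∏ c ∈ w j, ((fun _ : Fin 1 => ty) p none c + ∑ q ∈ J, (fun _ : Fin 1 => ty) p (some q) c))) =
      Matrix.of fun i j : Fin r => ∑ J : Finset (Fin K), (∏ k ∈ J, lam k) *
        ((∏ a ∈ u i, (tx none a + ∑ q ∈ J, tx (some q) a)) *
          ∏ c ∈ w j, (ty none c + ∑ q ∈ J, ty (some q) c)) := by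
    refine Matrix.ext fun i j => ?_
    simp only [Matrix.of_apply, Fin.sum_univ_one, one_mul]
  rw [hmat]
  exact hdet

/-- **UTD ⇒ the registered weakest node** (composition of arrows 2 and 3). -/
theorem fullJoinPairLower_of_universalThresholdDesign (H : Stmt.universalThresholdDesign) : Stmt.fullJoinPairLower :=
  fullJoinPairLower_of_fullJoinCubeWide (fullJoinCubeWide_of_universalThresholdDesign H)

end FullJoin

end

end Summit.ValiantsHypothesis.ValiantsHypothesis.Theorems.BarrierLever.HiddenStates
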